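import Mathlib
import Literature.Analysis.Complex.Bieberbach
import Literature.Analysis.Complex.KoebeDistortion
import Summits.SmoothPoincare4.SmoothPoincare4.Theorems.SullivanDualTameOrBrodyR4StubExteriorSchwarz

/-!
# Stub `stub_sigmaGrowth` of line `Sketch` (skeleton v8) for crux `TameOrBrodyR4` (stmt-SmoothPoincare4-7826, route SullivanDual)

Growth of univalent maps at infinity (the class `Σ` with `b₀ = 0`). Let `ψ` be holomorphic and
injective on the exterior domain `{T < ‖c‖}` (`0 < T`) with `ψ c - c → 0` at infinity, and let `p`
be a value omitted by `ψ` there. Then `‖p‖ ≤ 2 T` and `‖ψ c‖ ≥ ‖c‖ - 4 T` for `T < ‖c‖`.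

How (Pommerenke, *Boundary behaviour of conformal maps*, §1.3): rescale to `g ζ = ψ(T ζ)/T`,
which is holomorphic and injective on `{1 < ‖ζ‖}`, satisfies `g ζ - ζ → 0` at infinity and omits
`q = p/T` (`SigmaGrowth.main`). The pulled-back error `u s = g(1/s) - 1/s` (`u 0 = 0`) is
holomorphic on the unit disc by the removable singularity theorem at infinity
(`ExteriorSchwarz.differentiableOn_update_inv`), so the Koebe-type transform
`F s = s / (1 + s u(s) - q s)` (`= 1/(g(1/s) - q)` off the origin) is holomorphic on the unit
disc with `F 0 = 0`, `F' 0 = 1`, second coefficient `(dslope F 0)' 0 = q`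
(`SigmaGrowth.koebe_aux`), and injective (`g` is). Bieberbach's theorem
(`Literature.Analysis.Complex.AreaThm.norm_deriv_dslope_le_two`) gives `‖q‖ ≤ 2`, and the growth
theorem (`Literature.Analysis.Complex.AreaThm.norm_sub_le_growth`) at `s = 1/ζ` gives
`‖g ζ - q‖ ≥ (‖ζ‖ - 1)²/‖ζ‖ ≥ ‖ζ‖ - 2`, whence `‖g ζ‖ ≥ ‖ζ‖ - 4`; scale back.

Sources: Ch. Pommerenke, *Boundary Behaviour of Conformal Maps* (Springer, 1992), §1.3
(Bieberbach's theorem, eq. (9); growth theorem, Thm. 1.3); L. Bieberbach (1916).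
-/

open scoped Topology
open Filter Set Metric Function

-- the registered namespace `Summit.SmoothPoincare4.SmoothPoincare4.…` repeats a component
set_option linter.dupNamespace false

noncomputable section

namespace Summit.SmoothPoincare4.SmoothPoincare4.Cruxes.TameOrBrodyR4.Sketch

namespace SigmaGrowth

open Literature.Analysis.Complex

variable {u g : ℂ → ℂ} {q : ℂ}

/-- The denominator `D s = 1 + s u(s) - q s` of the Koebe-type transform has derivative `-q` at
the origin when `u 0 = 0`. -/
theorem hasDerivAt_denom (hu : DifferentiableOn ℂ u (ball 0 1)) (hu0 : u 0 = 0) :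
    HasDerivAt (fun s : ℂ => 1 + s * u s - q * s) (-q) 0 := by
  have h0 : ball (0 : ℂ) 1 ∈ 𝓝 (0 : ℂ) := ball_mem_nhds 0 one_pos
  have hu' : HasDerivAt u (deriv u 0) 0 := (hu.differentiableAt h0).hasDerivAt
  have h1 : HasDerivAt (fun s : ℂ => s * u s) (1 * u 0 + 0 * deriv u 0) 0 :=
    (hasDerivAt_id' (0 : ℂ)).fun_mul hu'
  have h2 : HasDerivAt (fun s : ℂ => 1 + s * u s - q * s)
      ((1 * u 0 + 0 * deriv u 0) - q * 1) 0 :=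
    (h1.const_add 1).fun_sub ((hasDerivAt_id' (0 : ℂ)).const_mul q)
  convert h2 using 1
  rw [hu0]; ring

/-- The denominator `D s = 1 + s u(s) - q s` is holomorphic on the unit disc. -/
theorem differentiableOn_denom (hu : DifferentiableOn ℂ u (ball 0 1)) :
    DifferentiableOn ℂ (fun s : ℂ => 1 + s * u s - q * s) (ball 0 1) :=
  ((differentiableOn_id.fun_mul hu).const_add 1).fun_sub (differentiableOn_id.const_mul q)

/-- **The Koebe-type transform is in class `S` with second coefficient `q`.** For `u` holomorphic
on the unit disc with `u 0 = 0` and `D s = 1 + s u(s) - q s` zero-free there, the function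
`F s = s / D s` is holomorphic on the unit disc, `F' 0 = 1`, and `(dslope F 0)' 0 = q`
(indeed `dslope F 0 = 1/D` and `D' 0 = -q`). -/
theorem koebe_aux (hu : DifferentiableOn ℂ u (ball 0 1)) (hu0 : u 0 = 0)
    (hD : ∀ s ∈ ball (0 : ℂ) 1, 1 + s * u s - q * s ≠ 0) :
    DifferentiableOn ℂ (fun s : ℂ => s / (1 + s * u s - q * s)) (ball 0 1) ∧
    deriv (fun s : ℂ => s / (1 + s * u s - q * s)) 0 = 1 ∧
    deriv (dslope (fun s : ℂ => s / (1 + s * u s - q * s)) 0) 0 = q := by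
  set D : ℂ → ℂ := fun s => 1 + s * u s - q * s with hDdef
  have hD0 : D 0 = 1 := by simp [hDdef]
  have hD0' : D 0 ≠ 0 := by rw [hD0]; exact one_ne_zero
  have hDd : DifferentiableOn ℂ D (ball 0 1) := differentiableOn_denom hu
  have hD' : HasDerivAt D (-q) 0 := hasDerivAt_denom hu hu0
  have hFd : DifferentiableOn ℂ (fun s : ℂ => s / D s) (ball 0 1) :=
    differentiableOn_id.fun_div hDd hD
  have hF' : HasDerivAt (fun s : ℂ => s / D s) 1 0 := by
    have h : HasDerivAt (fun s : ℂ => s / D s) ((1 * D 0 - 0 * -q) / D 0 ^ 2) 0 :=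
      (hasDerivAt_id' (0 : ℂ)).fun_div hD' hD0'
    convert h using 1
    rw [hD0]; simp
  have hds : dslope (fun s : ℂ => s / D s) 0 = fun s => (D s)⁻¹ := by
    funext s
    by_cases hs : s = 0
    · rw [hs, dslope_same, hF'.deriv, hD0, inv_one]
    · rw [dslope_of_ne _ hs, slope_def_field, zero_div, sub_zero, sub_zero, div_div,
        mul_comm, ← div_div, div_self hs, one_div]
  refine ⟨hFd, hF'.deriv, ?_⟩
  rw [hds]
  have h : HasDerivAt (fun s : ℂ => (D s)⁻¹) (-(-q) / D 0 ^ 2) 0 := hD'.fun_inv hD0'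
  rw [h.deriv, hD0]
  simp

/-- For `s` in the punctured unit disc, `1 < ‖s⁻¹‖`. -/
theorem one_lt_norm_inv {s : ℂ} (hs : s ∈ ball (0 : ℂ) 1) (hs0 : s ≠ 0) : 1 < ‖s⁻¹‖ := by
  rw [norm_inv]
  exact (one_lt_inv₀ (norm_pos_iff.mpr hs0)).mpr (mem_ball_zero_iff.mp hs)

/-- The pulled-back error `u s = g(1/s) - 1/s` (`u 0 = 0`) of a map `g` holomorphic on
`{1 < ‖ζ‖}` with `g ζ - ζ → 0` at infinity is holomorphic on the unit disc (removable
singularity at infinity, `ExteriorSchwarz.differentiableOn_update_inv`). -/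
theorem differentiableOn_err (hg : DifferentiableOn ℂ g {ζ : ℂ | 1 < ‖ζ‖})
    (hgn : Tendsto (fun ζ => g ζ - ζ) (cocompact ℂ) (𝓝 0)) :
    DifferentiableOn ℂ (update (fun s : ℂ => g s⁻¹ - s⁻¹) 0 0) (ball 0 1) := by
  have h := ExteriorSchwarz.differentiableOn_update_inv (fun ζ => g ζ - ζ) one_pos
    (hg.fun_sub differentiableOn_id) hgn
  rwa [inv_one] at h

/-- Off the origin the denominator of the Koebe-type transform is `s (g(1/s) - q)`. -/
theorem denom_eq {s : ℂ} (hs : s ≠ 0) (g : ℂ → ℂ) (q : ℂ) :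
    1 + s * update (fun s : ℂ => g s⁻¹ - s⁻¹) 0 0 s - q * s = s * (g s⁻¹ - q) := by
  rw [update_of_ne hs, mul_sub, mul_inv_cancel₀ hs]
  ring

/-- Elementary inversion of the growth bound: `m⁻¹ ≤ r⁻¹/(1 - r⁻¹)²` with `1 < r`, `0 < m`
gives `r - 2 ≤ m` (indeed `m ≥ (r - 1)²/r = r - 2 + 1/r`). -/
theorem sub_two_le {r m : ℝ} (hr : 1 < r) (hm : 0 < m) (h : m⁻¹ ≤ r⁻¹ / (1 - r⁻¹) ^ 2) :
    r - 2 ≤ m := by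
  have hr0 : 0 < r := one_pos.trans hr
  have hr1 : (r - 1) ≠ 0 := (sub_pos.mpr hr).ne'
  have h1 : r⁻¹ / (1 - r⁻¹) ^ 2 = r / (r - 1) ^ 2 := by
    field_simp
  rw [h1] at h
  have h2 : (r / (r - 1) ^ 2)⁻¹ ≤ m := inv_le_of_inv_le₀ hm h
  rw [inv_div] at h2
  refine le_trans ?_ h2
  rw [le_div_iff₀ hr0]
  nlinarith

/-- **Omitted values and growth for the class `Σ` with `b₀ = 0`** (Pommerenke (1992), §1.3).
If `g` is holomorphic and injective on `{1 < ‖ζ‖}` with `g ζ - ζ → 0` at infinity and omits the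
value `q` there, then `‖q‖ ≤ 2` (Bieberbach's theorem for the Koebe-type transform
`F s = 1/(g(1/s) - q) ∈ S`, whose second coefficient is `q`) and `‖g ζ - q‖ ≥ ‖ζ‖ - 2` for
`1 < ‖ζ‖` (the growth theorem `‖F s‖ ≤ ‖s‖/(1 - ‖s‖)²` at `s = 1/ζ`). -/
theorem main (hg : DifferentiableOn ℂ g {ζ : ℂ | 1 < ‖ζ‖}) (hinj : InjOn g {ζ : ℂ | 1 < ‖ζ‖})
    (hgn : Tendsto (fun ζ => g ζ - ζ) (cocompact ℂ) (𝓝 0)) (hq : ∀ ζ : ℂ, 1 < ‖ζ‖ → g ζ ≠ q) :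
    ‖q‖ ≤ 2 ∧ ∀ ζ : ℂ, 1 < ‖ζ‖ → ‖ζ‖ - 2 ≤ ‖g ζ - q‖ := by
  set u : ℂ → ℂ := update (fun s : ℂ => g s⁻¹ - s⁻¹) 0 0 with hudef
  have hu : DifferentiableOn ℂ u (ball 0 1) := differentiableOn_err hg hgn
  have hu0 : u 0 = 0 := update_self ..
  set D : ℂ → ℂ := fun s => 1 + s * u s - q * s with hDdef
  set F : ℂ → ℂ := fun s => s / D s with hFdef
  have hmem : ∀ s ∈ ball (0 : ℂ) 1, s ≠ 0 → 1 < ‖s⁻¹‖ := fun s hs hs0 => one_lt_norm_inv hs hs0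
  have hDs : ∀ s : ℂ, s ≠ 0 → D s = s * (g s⁻¹ - q) := fun s hs => denom_eq hs g q
  have hgq : ∀ s ∈ ball (0 : ℂ) 1, s ≠ 0 → g s⁻¹ - q ≠ 0 := fun s hs hs0 =>
    sub_ne_zero.mpr (hq _ (hmem s hs hs0))
  have hD0 : D 0 = 1 := by simp [hDdef]
  have hDne : ∀ s ∈ ball (0 : ℂ) 1, D s ≠ 0 := by
    intro s hs
    by_cases hs0 : s = 0
    · rw [hs0, hD0]; exact one_ne_zero
    · rw [hDs s hs0]; exact mul_ne_zero hs0 (hgq s hs hs0)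
  have hFs : ∀ s : ℂ, s ≠ 0 → F s = (g s⁻¹ - q)⁻¹ := by
    intro s hs
    simp only [hFdef]
    rw [hDs s hs, div_mul_eq_div_div, div_self hs, one_div]
  obtain ⟨hFd, hF1, hF2⟩ :
      DifferentiableOn ℂ F (ball 0 1) ∧ deriv F 0 = 1 ∧ deriv (dslope F 0) 0 = q :=
    koebe_aux hu hu0 hDne
  have hF0 : F 0 = 0 := by simp [hFdef]
  -- `F` is injective on the disc
  have hFinj : InjOn F (ball 0 1) := by
    intro s₁ hs₁ s₂ hs₂ heq
    by_cases h1 : s₁ = 0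
    · by_contra h2
      have h2' : s₂ ≠ 0 := fun h => h2 (h1.trans h.symm)
      rw [h1, hF0, hFs s₂ h2'] at heq
      exact inv_ne_zero (hgq s₂ hs₂ h2') heq.symm
    by_cases h2 : s₂ = 0
    · rw [h2, hF0, hFs s₁ h1] at heq
      exact absurd heq (inv_ne_zero (hgq s₁ hs₁ h1))
    rw [hFs s₁ h1, hFs s₂ h2, inv_inj, sub_left_inj] at heq
    exact inv_inj.mp (hinj (hmem s₁ hs₁ h1) (hmem s₂ hs₂ h2) heq)
  refine ⟨?_, fun ζ hζ => ?_⟩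
  · -- Bieberbach's theorem
    have h := AreaThm.norm_deriv_dslope_le_two hFd hFinj hF0 hF1
    rwa [hF2] at h
  · -- the growth theorem at `s = 1/ζ`
    have hζ0 : ζ ≠ 0 := by
      rintro rfl
      rw [norm_zero] at hζ
      exact absurd hζ (not_lt.mpr zero_le_one)
    have hs0 : ζ⁻¹ ≠ 0 := inv_ne_zero hζ0
    have hsn : ‖ζ⁻¹‖ = ‖ζ‖⁻¹ := norm_inv ζ
    have hs1 : ‖ζ⁻¹‖ < 1 := by rw [hsn]; exact inv_lt_one_of_one_lt₀ hζ
    have key := AreaThm.norm_sub_le_growth hFd hFinj hs1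
    rw [hF0, sub_zero, hF1, norm_one, one_mul, hFs _ hs0, inv_inv, norm_inv, hsn] at key
    have hm : 0 < ‖g ζ - q‖ := norm_pos_iff.mpr (sub_ne_zero.mpr (hq ζ hζ))
    exact sub_two_le hζ hm key

end SigmaGrowth

/-- **Stub (classical): growth of univalent maps at infinity.** If `ψ` is holomorphic and injective
on `{|c| > T}` with `ψ(c) - c → 0` at infinity and omits the value `p` there, then `|p| ≤ 2T` and
`|ψ(c)| ≥ |c| - 4T`. Proof: rescale to `g(ζ) = ψ(Tζ)/T`, which is holomorphic and injective on
`{|ζ| > 1}` with `g(ζ) - ζ → 0` and omits `q = p/T`; by `SigmaGrowth.main` (Bieberbach's theorem and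
the growth theorem for the Koebe-type transform `F(s) = 1/(g(1/s) - q) ∈ S`) `|q| ≤ 2` and
`|g(ζ) - q| ≥ |ζ| - 2`, hence `|ψ c - p| ≥ |c| - 2T` and `|ψ c| ≥ |c| - 2T - |p| ≥ |c| - 4T`. -/
theorem stub_sigmaGrowth (T : ℝ) (hT : 0 < T) (ψ : ℂ → ℂ)
    (hψ : DifferentiableOn ℂ ψ {c : ℂ | T < ‖c‖}) (hinj : Set.InjOn ψ {c : ℂ | T < ‖c‖})
    (hψn : Tendsto (fun c => ψ c - c) (cocompact ℂ) (𝓝 0))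
    (p : ℂ) (hp : ∀ c : ℂ, T < ‖c‖ → ψ c ≠ p) :
    ‖p‖ ≤ 2 * T ∧ ∀ c : ℂ, T < ‖c‖ → ‖c‖ - 4 * T ≤ ‖ψ c‖ := by
  have hT0 : (T : ℂ) ≠ 0 := Complex.ofReal_ne_zero.mpr hT.ne'
  have hnT : ‖(T : ℂ)‖ = T := Complex.norm_of_nonneg hT.le
  -- the rescaled map `g ζ = ψ(T ζ)/T` and the rescaled omitted value `q = p/T`
  set g : ℂ → ℂ := fun ζ => (T : ℂ)⁻¹ * ψ (T * ζ) with hgdef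
  have hmem : ∀ ζ : ℂ, 1 < ‖ζ‖ → T < ‖(T : ℂ) * ζ‖ := fun ζ hζ => by
    rw [norm_mul, hnT]
    have h := mul_lt_mul_of_pos_left hζ hT
    rwa [mul_one] at h
  have hg : DifferentiableOn ℂ g {ζ : ℂ | 1 < ‖ζ‖} :=
    (hψ.comp (differentiableOn_id.const_mul _) fun ζ hζ => hmem ζ hζ).const_mul _
  have hginj : InjOn g {ζ : ℂ | 1 < ‖ζ‖} := by
    intro ζ₁ h₁ ζ₂ h₂ heq
    have h : ψ (T * ζ₁) = ψ (T * ζ₂) := mul_left_cancel₀ (inv_ne_zero hT0) heq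
    exact mul_left_cancel₀ hT0 (hinj (hmem ζ₁ h₁) (hmem ζ₂ h₂) h)
  have hgn : Tendsto (fun ζ => g ζ - ζ) (cocompact ℂ) (𝓝 0) := by
    have h1 : Tendsto (fun ζ : ℂ => (T : ℂ) * ζ) (cocompact ℂ) (cocompact ℂ) := by
      rw [← Metric.cobounded_eq_cocompact]
      exact Filter.tendsto_mul_left_cobounded hT0
    have h2 := (hψn.comp h1).const_mul (T : ℂ)⁻¹
    rw [mul_zero] at h2
    refine h2.congr fun ζ => ?_
    simp only [Function.comp_apply, hgdef]
    rw [mul_sub, inv_mul_cancel_left₀ hT0]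
  have hgq : ∀ ζ : ℂ, 1 < ‖ζ‖ → g ζ ≠ (T : ℂ)⁻¹ * p := fun ζ hζ h =>
    hp _ (hmem ζ hζ) (mul_left_cancel₀ (inv_ne_zero hT0) h)
  obtain ⟨hq2, hgrowth⟩ := SigmaGrowth.main hg hginj hgn hgq
  -- scale back
  have hp2 : ‖p‖ ≤ 2 * T := by
    rw [norm_mul, norm_inv, hnT, inv_mul_le_iff₀ hT] at hq2
    linarith
  refine ⟨hp2, fun c hc => ?_⟩
  have hζ : 1 < ‖(T : ℂ)⁻¹ * c‖ := by
    rw [norm_mul, norm_inv, hnT, lt_inv_mul_iff₀ hT, mul_one]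
    exact hc
  have h := hgrowth _ hζ
  have hgc : g ((T : ℂ)⁻¹ * c) = (T : ℂ)⁻¹ * ψ c := by
    simp only [hgdef]
    rw [mul_inv_cancel_left₀ hT0]
  rw [hgc, ← mul_sub, norm_mul, norm_mul, norm_inv, hnT] at h
  have h3 : ‖ψ c - p‖ ≤ ‖ψ c‖ + ‖p‖ := norm_sub_le _ _
  have h4 : ‖c‖ - 2 * T ≤ ‖ψ c - p‖ := by
    have h5 := mul_le_mul_of_nonneg_left h hT.le
    rw [mul_sub, mul_inv_cancel_left₀ hT.ne', mul_inv_cancel_left₀ hT.ne'] at h5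
    linarith
  linarith

end Summit.SmoothPoincare4.SmoothPoincare4.Cruxes.TameOrBrodyR4.Sketch
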